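import Literature.NumberTheory.LFunctions.TaoCircleMethod
import Mathlib.NumberTheory.Chebyshev
import HarnessLib

/-!
# Tao's log-averaged Elliott theorem: Lemma 3.6 (circle method estimate) for general `c_p`,
# and few large frequencies via the fourth moment

Part of the proof DAG below the named fact `Literature.NumberTheory.LFunctions.Tao2016_theorem23` (Tao, Forum Math. Pi 4
(2016) e8, Theorem 2.3, for two arbitrary completely multiplicative `S¹`-valued `g₁, g₂`),
whose printed proof (§3 of the paper) ends with three deterministic estimates: Lemma 3.5
(Hoeffding), **Lemma 3.6 (circle method estimate)** and Lemma 3.7 (restriction theorem for the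
primes).  `TaoCircleMethod.lean` proves Lemma 3.6 in the Liouville case `c_p = 1` singled out
after Proposition 2.6 of the paper, together with the finite Fourier toolkit on `ℤ/Hℤ`
(`dft`, `pext`, `sum_e_mul_div`, Plancherel `sum_norm_sq_dft_comp_le_one`,
`card_filter_add_not_mem_Icc_le`) and the fourth-moment count `card_largeFreq_le`.  This file is
built on that toolkit (same namespace, same `e = Literature.VdC.e`, same `ℤ`-indexed sequences
`x : ℤ → ℂ` on `Icc 1 H`) and adds the general Elliott case, everything PROVED:

* `expSumS 𝒫 c θ = ∑_{p∈𝒫} (c_p/p) e(θp)` — `S_H` with the phases `c_p = ḡ₁(p)ḡ₂(p)` of the paper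
  (`primeExpSum_eq_expSumS_one : primeExpSum P θ = expSumS P 1 θ`);
  `alpha a N b h ξ η = -(b+h)η/a - hξ/N` — Tao's frequencies verbatim; `Xi 𝒫 c a N b h δ` — the
  exceptional set `Ξ_H` in that parametrisation.  `Xi` is kept alongside `largeFreq` (which uses
  `hξ/H - bη/a` and carries `G₂`) because for `x₁ ≠ x₂` the printed bound carries `G₁`, the
  transform of the *first* factor, which is what display (2.11) of the paper controls; for
  general `c_p ∈ S¹`, `Ξ_H` "need not be contained within major arcs" (Remark 3.8).
* `inner_identity` — the Fourier expansion behind Lemma 3.6, for `N = aH'`, `x₁, x₂` periodic: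
  `∑_{j∈ℤ/Nℤ} 1_{j≡pb (a)} x₁(j) x₂(j+ph) = (N/a) ∑_{η∈ℤ/aℤ} ∑_{ξ∈ℤ/Nℤ} G₁(ξ) G₂(-ξ-ηN/a) e(α(ξ,η)p)`;
* `lemma36_periodic` — `|∑_p (c_p/p) ∑_{j∈ℤ/Nℤ} 1_{j≡pb (a)} x₁(j)x₂(j+ph)| ≤ N (δ + σ ∑_{ξ∈Ξ} |G₁(ξ)|)`,
  `σ = ∑_p 1/p`, for any finite `𝒫` and `1`-bounded `c` on `𝒫`;
* `bilinC` — `bilin` with phases (`bilin_eq_bilinC_one`); `norm_bilinC_sub_periodic_le` —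
  removing the constraint `j + ph ∈ [1, N]` costs `≤ |h| · #𝒫`;
* `primesP ε H` — `𝒫_H`, the primes in `[ε²H/2, ε²H]` (Prop. 2.6); `card_primesP_le` — Chebyshev
  (`Chebyshev.theta_le_log4_mul_x`): for `ε⁴H ≥ 4`, `#𝒫_H ≤ 3ε²H/log H`, `∑_{p∈𝒫_H} 1/p ≤ 6/log H`;
* `lemma36` — **Lemma 3.6 as printed**: for `a ≥ 1`, `a ∣ H`, `0 < ε ≤ 1`, `ε⁴H ≥ 4`,
  `|c_p| ≤ 1` on `𝒫_H`, `|x_{i,j}| ≤ 1` on `[1, H]`,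
  `|bilinC| ≤ (6 + 3|h|) (H/log H) (ε² + ∑_{ξ∈Ξ_H} |G₁(ξ)|)`, `G₁ = dft H x₁`;
* `card_Xi_le` — few large frequencies for general `c` (first half of the proof of Lemma 3.7 via
  additive quadruples, as in the footnote there): `#Ξ ≤ a N δ⁻⁴ p_min⁻⁴ #addQuadruples 𝒫`.

Small complements to the toolkit (all proved): collapse `sum_range_ite_dvd_sub`, reindexing of
periodic sums (`sum_range_periodic_sub/add`, `sum_Icc_int_eq_sum_range_of_periodic`),
`pext_periodic`, `dft_eq_sum_range` (a period may be taken to be `[0, N)`).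

## References
* T. Tao, *The logarithmically averaged Chowla and Elliott conjectures for two-point
  correlations*, Forum Math. Pi 4 (2016), e8; arXiv:1509.05422, §3: Lemma 3.6 and its proof,
  Lemma 3.7 (proof and footnote), Remark 3.8; Proposition 2.6 (definition of `𝒫_H`).

## Design choices / deviations
* The paper's constant in Lemma 3.6 is `≪_{a,h}`; ours, `6 + 3|h|`, is uniform in `a`.  The
  hypothesis `ε⁴H ≥ 4` (in the paper: `H ≥ H₋` large depending on `ε`) is only used to replace
  `log(ε²H/2)` by `(1/2) log H` in Chebyshev's bound; `lemma36_periodic` has no such hypothesis.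
* `c_p` is only assumed `1`-bounded on `𝒫` (the paper has `c_p ∈ S¹`).
* Internally the period is `range N` (integer phases, `ℕ`-valued summation indices); the bridge
  to the `Icc (1 : ℤ) H` convention of `TaoCircleMethod.lean` is `dft_eq_sum_range` /
  `sum_Icc_int_eq_sum_range_of_periodic`.
-/

open Finset Real Complex
open scoped ComplexConjugate

namespace Literature.NumberTheory.LFunctions

namespace Tao2016

open VdC

/-! ### Residue classes and periodic sums on `ℤ/Nℤ` (complements to `TaoCircleMethod.lean`) -/

/-- For `0 ≤ j, k < N`: `N ∣ k - j` iff `k = j`. [folklore] -/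
theorem natCast_dvd_sub_iff {N j k : ℕ} (hj : j < N) (hk : k < N) :
    (N : ℤ) ∣ (k : ℤ) - j ↔ k = j := by
  constructor
  · intro h
    have h1 : (j : ℤ) ≡ k [ZMOD N] := Int.modEq_iff_dvd.2 h
    have h2 : j ≡ k [MOD N] := Int.natCast_modEq_iff.1 h1
    have h3 : j % N = k % N := h2
    rw [Nat.mod_eq_of_lt hj, Nat.mod_eq_of_lt hk] at h3
    exact h3.symm
  · rintro rfl; simp

/-- Collapse of a sum against the indicator of a residue class: for `F` periodic with period `N`,
`∑_{k<N} 1_{N ∣ k - m} F(k) = F(m)`. [folklore] -/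
theorem sum_range_ite_dvd_sub {M : Type*} [AddCommMonoid M] {F : ℤ → M} {N : ℕ} (hN : 0 < N)
    (hF : Function.Periodic F N) (m : ℤ) :
    ∑ k ∈ range N, (if (N : ℤ) ∣ (k : ℤ) - m then F k else 0) = F m := by
  have hN' : (0 : ℤ) < N := by exact_mod_cast hN
  set k₀ : ℕ := (m % N).toNat with hk₀
  have hk₀' : (k₀ : ℤ) = m % N := Int.toNat_of_nonneg (Int.emod_nonneg _ hN'.ne')
  have hk₀N : k₀ < N := by
    have := Int.emod_lt_of_pos m hN'
    omega
  have hiff : ∀ k ∈ range N, ((N : ℤ) ∣ (k : ℤ) - m ↔ k = k₀) := by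
    intro k hk
    rw [mem_range] at hk
    rw [← natCast_dvd_sub_iff hk₀N hk, hk₀']
    rw [← Int.modEq_iff_dvd, ← Int.modEq_iff_dvd]
    exact ⟨fun h => (Int.mod_modEq m N).trans h, fun h => (Int.mod_modEq m N).symm.trans h⟩
  rw [← Finset.sum_filter]
  have hfilter : (range N).filter (fun k : ℕ => (N : ℤ) ∣ (k : ℤ) - m) = ({k₀} : Finset ℕ) := by
    ext k
    simp only [mem_filter, mem_range, mem_singleton]
    constructor
    · rintro ⟨hk, h⟩; exact (hiff k (mem_range.2 hk)).1 h
    · rintro rfl; exact ⟨hk₀N, (hiff k₀ (mem_range.2 hk₀N)).2 rfl⟩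
  rw [hfilter, sum_singleton, hk₀', Int.emod_def, sub_eq_add_neg, ← neg_mul, mul_comm]
  have := hF.int_mul (-(m / N)) m
  rw [Int.cast_id] at this
  rw [show m + m / ↑N * -(N : ℤ) = m + -(m / ↑N) * ↑N by ring, this]

/-- A periodic function only depends on the residue: `F (m % N) = F m`. [folklore] -/
theorem periodic_emod {M : Type*} {F : ℤ → M} {N : ℕ} (hF : Function.Periodic F N) (m : ℤ) :
    F (m % N) = F m := by
  rw [Int.emod_def, show m - (N : ℤ) * (m / N) = m - (m / N) * N by ring]
  have := hF.sub_int_mul_eq (x := m) (m / N)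
  rwa [Int.cast_id] at this

/-- Sums of an `N`-periodic function over a period are invariant under the reflections
`ξ ↦ c - ξ`. [folklore] -/
theorem sum_range_periodic_sub {M : Type*} [AddCommMonoid M] {F : ℤ → M} {N : ℕ} (hN : 0 < N)
    (hF : Function.Periodic F N) (c : ℤ) :
    ∑ ξ ∈ range N, F (c - ξ) = ∑ ξ ∈ range N, F ξ := by
  have hN' : (0 : ℤ) < N := by exact_mod_cast hN
  set T : ℕ → ℕ := fun ξ => ((c - ξ) % N).toNat with hT
  have hT1 : ∀ ξ : ℕ, ((T ξ : ℕ) : ℤ) = (c - ξ) % N := fun ξ =>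
    Int.toNat_of_nonneg (Int.emod_nonneg _ hN'.ne')
  have hT2 : ∀ ξ : ℕ, T ξ < N := fun ξ => by
    have h1 := Int.emod_lt_of_pos (c - ξ) hN'
    have h2 := hT1 ξ
    omega
  have hT3 : ∀ ξ ∈ range N, T (T ξ) = ξ := by
    intro ξ hξ
    rw [mem_range] at hξ
    have h1 : ((T (T ξ) : ℕ) : ℤ) = ξ := by
      rw [hT1, hT1]
      have h2 : (c - (c - ↑ξ) % ↑N) ≡ (c - (c - ↑ξ)) [ZMOD (N : ℤ)] :=
        Int.ModEq.sub_left c (Int.mod_modEq _ _)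
      rw [h2, sub_sub_cancel, Int.emod_eq_of_lt (by positivity) (by exact_mod_cast hξ)]
    exact_mod_cast h1
  refine Finset.sum_nbij' T T (fun ξ _ => mem_range.2 (hT2 ξ)) (fun ξ _ => mem_range.2 (hT2 ξ))
    hT3 hT3 ?_
  intro ξ _
  rw [hT1, periodic_emod hF]

/-- Sums of an `N`-periodic function over a period are invariant under translations
`ξ ↦ c + ξ`. [folklore] -/
theorem sum_range_periodic_add {M : Type*} [AddCommMonoid M] {F : ℤ → M} {N : ℕ} (hN : 0 < N)
    (hF : Function.Periodic F N) (c : ℤ) :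
    ∑ ξ ∈ range N, F (c + ξ) = ∑ ξ ∈ range N, F ξ := by
  set G : ℤ → M := fun m => F (-m) with hG
  have hGp : Function.Periodic G N := by
    intro m
    simp only [hG, neg_add]
    rw [← sub_eq_add_neg]
    exact hF.sub_eq (-m)
  calc ∑ ξ ∈ range N, F (c + ξ) = ∑ ξ ∈ range N, G (-c - ξ) := by
        refine sum_congr rfl fun ξ _ => ?_; simp only [hG]; congr 1; ring
    _ = ∑ ξ ∈ range N, G ξ := sum_range_periodic_sub hN hGp _
    _ = ∑ ξ ∈ range N, F (0 - ξ) := by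
        refine sum_congr rfl fun ξ _ => ?_; simp only [hG, zero_sub]
    _ = ∑ ξ ∈ range N, F ξ := sum_range_periodic_sub hN hF 0

/-- A period of an `N`-periodic function on `ℤ` may be taken to be `[0, N)` or the integer
interval `[1, N]`. [folklore] -/
theorem sum_Icc_int_eq_sum_range_of_periodic {M : Type*} [AddCommMonoid M] {F : ℤ → M} {N : ℕ}
    (hN : 0 < N) (hF : Function.Periodic F N) :
    ∑ j ∈ Icc (1 : ℤ) N, F j = ∑ j ∈ range N, F j := by
  have h1 : ∑ j ∈ Icc (1 : ℤ) N, F j = ∑ j ∈ range N, F (1 + j) := by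
    rw [Int.Icc_eq_finset_map, sum_map]
    simp
  rw [h1]
  exact sum_range_periodic_add hN hF 1

/-- `x̃ = pext H x` is `H`-periodic (repackaging of `pext_add_mul`). [folklore] -/
theorem pext_periodic {H : ℕ} (hH : 0 < H) (x : ℤ → ℂ) : Function.Periodic (pext H x) H := by
  intro m
  have := pext_add_mul H hH x m 1
  rwa [mul_one] at this

/-- For an `N`-periodic `x`, the Fourier coefficient `G(ξ) = dft N x ξ` may be computed over the
period `[0, N)`: `G(ξ) = (1/N) ∑_{j<N} x(j) e(-jξ/N)`. [folklore] -/
theorem dft_eq_sum_range {N : ℕ} (hN : 0 < N) {x : ℤ → ℂ} (hx : Function.Periodic x N) (ξ : ℤ) :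
    dft N x ξ = (1 / N : ℂ) * ∑ j ∈ range N, x j * e (-((j : ℝ) * ξ / N)) := by
  unfold dft
  congr 1
  have hF : Function.Periodic (fun j : ℤ => x j * e (-((j : ℝ) * ξ / N))) N := by
    intro j
    simp only
    rw [hx j]
    congr 1
    push_cast
    rw [show -(((j : ℝ) + N) * ξ / N) = -((j : ℝ) * ξ / N) - ((ξ : ℤ) : ℝ) by
      field_simp [(by exact_mod_cast hN.ne' : (N : ℝ) ≠ 0)]; ring]
    exact e_sub_int _ _
  have h1 := sum_Icc_int_eq_sum_range_of_periodic hN hF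
  convert h1 using 2
  push_cast; rfl

/-! ### `S_H` with coefficients, Tao's frequencies `α(ξ, η)`, and `Ξ_H` -/

section Defs

/-- The prime exponential sum with coefficients, `S(θ) = ∑_{p ∈ 𝒫} (c_p / p) e(θ p)`
(Tao 2016, Lemma 3.6, definition of `S_H`, where `c_p = ḡ₁(p) ḡ₂(p)`); at `c = 1` this is
`Literature.NumberTheory.LFunctions.Tao2016.primeExpSum` (`primeExpSum_eq_expSumS_one`).
[cite: TaoFMP2016, Lemma 3.6 (definition of S_H)] -/
noncomputable def expSumS (P : Finset ℕ) (c : ℕ → ℂ) (θ : ℝ) : ℂ :=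
  ∑ p ∈ P, c p / p * e (θ * p)

/-- `primeExpSum P θ = expSumS P 1 θ` (the Liouville case `c_p = 1`). [folklore] -/
theorem primeExpSum_eq_expSumS_one (P : Finset ℕ) (θ : ℝ) :
    primeExpSum P θ = expSumS P 1 θ := by
  unfold primeExpSum expSumS
  refine sum_congr rfl fun p _ => ?_
  rw [Pi.one_apply]

/-- `|S(θ)| ≤ ∑_{p ∈ 𝒫} 1/p` for coefficients bounded by `1` on `𝒫`. [folklore] -/
theorem norm_expSumS_le {P : Finset ℕ} {c : ℕ → ℂ} (hc : ∀ p ∈ P, ‖c p‖ ≤ 1) (θ : ℝ) :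
    ‖expSumS P c θ‖ ≤ ∑ p ∈ P, (1 / p : ℝ) := by
  unfold expSumS
  refine (norm_sum_le _ _).trans (sum_le_sum fun p hp => ?_)
  rw [norm_mul, norm_e, mul_one, norm_div, Complex.norm_natCast]
  rcases Nat.eq_zero_or_pos p with rfl | hp0
  · simp
  · exact div_le_div_of_nonneg_right (hc p hp) (by positivity)

/-- The frequencies `α(ξ, η) = -(b+h)η/a - hξ/N` of Tao 2016, Lemma 3.6 (the arguments of `S_H`
in the definition of `Ξ_H`), verbatim. [cite: TaoFMP2016, Lemma 3.6] -/
noncomputable def alpha (a N : ℕ) (b h : ℤ) (ξ η : ℤ) : ℝ :=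
  -(((b : ℝ) + h) * η / a) - (h : ℝ) * ξ / N

/-- The exceptional frequency set `Ξ` of Tao 2016, Lemma 3.6, in Tao's parametrisation: those
`ξ ∈ ℤ/Nℤ` (represented in `[0, N)`) with `|S(-(b+h)η/a - hξ/N)| ≥ δ` for some `η ∈ ℤ/aℤ`
(the paper takes `δ = ε²/log H`).  Kept alongside `Literature.NumberTheory.LFunctions.Tao2016.largeFreq` (parametrisation
`hξ/H - bη/a`, large-frequency sum carrying `G₂`) because for `x₁ ≠ x₂` the printed bound carries
`G₁`, the transform of the *first* factor, which is what (2.11) of the paper controls.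
[cite: TaoFMP2016, Lemma 3.6] -/
noncomputable def Xi (P : Finset ℕ) (c : ℕ → ℂ) (a N : ℕ) (b h : ℤ) (δ : ℝ) : Finset ℕ :=
  (range N).filter fun ξ => ∃ η ∈ range a, δ ≤ ‖expSumS P c (alpha a N b h ξ η)‖

/-- `Ξ ⊆ [0, N)`. [folklore] -/
theorem Xi_subset (P : Finset ℕ) (c : ℕ → ℂ) (a N : ℕ) (b h : ℤ) (δ : ℝ) :
    Xi P c a N b h δ ⊆ range N := filter_subset _ _

end Defs

/-! ### The identity behind Lemma 3.6 -/

section Identity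

variable {a H' N : ℕ}

/-- Bookkeeping of phases in the proof of Lemma 3.6: for `N = aH'`,
`e(-jξ/N) e(k(ηH'+ξ)/N) e(α(ξ,η) p) = e((k-j-ph)ξ/N) e((k-ph-pb)η/a)`. [folklore] -/
theorem phase_combine (ha : 0 < a) (hH' : 0 < H') (hN : N = a * H') (b h : ℤ) (p : ℕ)
    (j k ξ η : ℕ) :
    e (-((j : ℝ) * (ξ : ℤ) / N)) * e (-((k : ℝ) * ((-((η : ℤ) * H' + ξ) : ℤ) : ℝ) / N)) *
      e (alpha a N b h ξ η * p) =
    e (((((k : ℤ) - (j + p * h) : ℤ)) : ℝ) * ξ / N) *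
      e (((((k : ℤ) - (p * h + p * b) : ℤ)) : ℝ) * η / a) := by
  rw [← e_add, ← e_add, ← e_add]
  congr 1
  unfold alpha
  subst hN
  have ha' : (a : ℝ) ≠ 0 := by exact_mod_cast ha.ne'
  have hH'' : (H' : ℝ) ≠ 0 := by exact_mod_cast hH'.ne'
  push_cast
  field_simp
  ring

/-- `a ∣ N` when `N = a H'`, as integers. [folklore] -/
theorem dvd_of_eq_mul (hN : N = a * H') : (a : ℤ) ∣ (N : ℤ) := ⟨H', by rw [hN]; push_cast; ring⟩

/-- **The identity behind Lemma 3.6** (Tao 2016, proof of Lemma 3.6, Fourier expansion of the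
periodised sum): for `N = aH'`, `x₁, x₂` `N`-periodic and any `p`,
`∑_{j ∈ ℤ/Nℤ} 1_{j ≡ pb (a)} x₁(j) x₂(j+ph)
  = (N/a) ∑_{η ∈ ℤ/aℤ} ∑_{ξ ∈ ℤ/Nℤ} G₁(ξ) G₂(-ξ - ηN/a) e(α(ξ,η) p)`,
`G_i = dft N x_i`, `α(ξ,η) = -(b+h)η/a - hξ/N`; summing against `c_p/p` produces `S_H(α(ξ,η))`.
[cite: TaoFMP2016, proof of Lemma 3.6] -/
theorem inner_identity (ha : 0 < a) (hH' : 0 < H') (hN : N = a * H') (b h : ℤ) (p : ℕ)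
    (x₁ x₂ : ℤ → ℂ) (hx₁ : Function.Periodic x₁ N) (hx₂ : Function.Periodic x₂ N) :
    ∑ j ∈ range N, (if (a : ℤ) ∣ (j : ℤ) - p * b then x₁ j * x₂ (j + p * h) else 0) =
    (N : ℂ) / a * ∑ η ∈ range a, ∑ ξ ∈ range N,
      dft N x₁ ξ * dft N x₂ (-((η : ℤ) * H' + ξ)) * e (alpha a N b h ξ η * p) := by
  have hNpos : 0 < N := hN ▸ Nat.mul_pos ha hH'
  have hNc : (N : ℂ) ≠ 0 := by exact_mod_cast hNpos.ne'
  have hac : (a : ℂ) ≠ 0 := by exact_mod_cast ha.ne'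
  -- the two phases after combination
  set E1 : ℕ → ℕ → ℕ → ℂ := fun ξ j k => e (((((k : ℤ) - (j + p * h) : ℤ)) : ℝ) * ξ / N)
    with hE1
  set E2 : ℕ → ℕ → ℂ := fun η k => e (((((k : ℤ) - (p * h + p * b) : ℤ)) : ℝ) * η / a)
    with hE2
  -- Step 1: expand each (η, ξ) term
  have step1 : ∀ η ξ : ℕ, dft N x₁ ξ * dft N x₂ (-((η : ℤ) * H' + ξ)) *
      e (alpha a N b h ξ η * p) =
      (1 / N : ℂ) * (1 / N : ℂ) *
        ∑ j ∈ range N, ∑ k ∈ range N, x₁ j * x₂ k * (E1 ξ j k * E2 η k) := by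
    intro η ξ
    rw [dft_eq_sum_range hNpos hx₁, dft_eq_sum_range hNpos hx₂, mul_mul_mul_comm, mul_assoc,
      sum_mul_sum, sum_mul]
    congr 1
    refine sum_congr rfl fun j _ => ?_
    rw [sum_mul]
    refine sum_congr rfl fun k _ => ?_
    have := phase_combine ha hH' hN b h p j k ξ η
    simp only [hE1, hE2]
    rw [← this]
    push_cast
    ring
  simp_rw [step1]
  simp_rw [← mul_sum]
  -- Step 2: interchange and factor
  have step2 : ∑ η ∈ range a, ∑ ξ ∈ range N, ∑ j ∈ range N, ∑ k ∈ range N,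
      x₁ j * x₂ k * (E1 ξ j k * E2 η k) =
      ∑ j ∈ range N, ∑ k ∈ range N, x₁ j * x₂ k *
        ((∑ ξ ∈ range N, E1 ξ j k) * ∑ η ∈ range a, E2 η k) := by
    symm
    simp_rw [sum_mul_sum, mul_sum]
    have r1 : ∀ j k : ℕ, ∑ ξ ∈ range N, ∑ η ∈ range a, x₁ j * x₂ k * (E1 ξ j k * E2 η k) =
        ∑ η ∈ range a, ∑ ξ ∈ range N, x₁ j * x₂ k * (E1 ξ j k * E2 η k) := fun _ _ => sum_comm
    simp_rw [r1]
    have r2 : ∀ j : ℕ, ∑ k ∈ range N, ∑ η ∈ range a, ∑ ξ ∈ range N,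
        x₁ j * x₂ k * (E1 ξ j k * E2 η k) =
        ∑ η ∈ range a, ∑ k ∈ range N, ∑ ξ ∈ range N, x₁ j * x₂ k * (E1 ξ j k * E2 η k) :=
      fun _ => sum_comm
    simp_rw [r2]
    rw [sum_comm]
    have r3 : ∀ η j : ℕ, ∑ k ∈ range N, ∑ ξ ∈ range N, x₁ j * x₂ k * (E1 ξ j k * E2 η k) =
        ∑ ξ ∈ range N, ∑ k ∈ range N, x₁ j * x₂ k * (E1 ξ j k * E2 η k) := fun _ _ => sum_comm
    simp_rw [r3]
    have r4 : ∀ η : ℕ, ∑ j ∈ range N, ∑ ξ ∈ range N, ∑ k ∈ range N,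
        x₁ j * x₂ k * (E1 ξ j k * E2 η k) =
        ∑ ξ ∈ range N, ∑ j ∈ range N, ∑ k ∈ range N, x₁ j * x₂ k * (E1 ξ j k * E2 η k) :=
      fun _ => sum_comm
    simp_rw [r4]
  rw [step2]
  -- Step 3: orthogonality
  simp only [hE1, hE2, sum_e_mul_div _ hNpos, sum_e_mul_div _ ha]
  -- Step 4: rearrange the indicator product
  set F : ℤ → ℂ := fun k => x₂ k * (if (a : ℤ) ∣ k - (p * h + p * b) then 1 else 0) with hF
  have hFp : Function.Periodic F N := by
    intro k
    simp only [hF]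
    rw [hx₂ k]
    congr 1
    have hdvd : (a : ℤ) ∣ (N : ℤ) := dvd_of_eq_mul hN
    have : ((a : ℤ) ∣ k + N - (p * h + p * b)) ↔ ((a : ℤ) ∣ k - (p * h + p * b)) := by
      rw [show k + (N : ℤ) - (p * h + p * b) = (k - (p * h + p * b)) + N by ring]
      exact dvd_add_left hdvd
    simp only [this]
  have step4 : ∀ j k : ℕ, x₁ j * x₂ k *
      ((if (N : ℤ) ∣ (k : ℤ) - (j + p * h) then (N : ℂ) else 0) *
        (if (a : ℤ) ∣ (k : ℤ) - (p * h + p * b) then (a : ℂ) else 0)) =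
      (N : ℂ) * a * (x₁ j * (if (N : ℤ) ∣ (k : ℤ) - (j + p * h) then F k else 0)) := by
    intro j k
    simp only [hF]
    split_ifs <;> ring
  simp_rw [step4]
  simp_rw [← mul_sum]
  -- Step 5: collapse the `k`-sum
  have step5 : ∀ j : ℕ, ∑ k ∈ range N, (if (N : ℤ) ∣ (k : ℤ) - (j + p * h) then F k else 0) =
      F ((j : ℤ) + p * h) := fun j => sum_range_ite_dvd_sub hNpos hFp _
  simp_rw [step5]
  simp only [hF]
  have key : ∀ S : ℂ, (N : ℂ) / a * ((1 / N : ℂ) * (1 / N : ℂ) * ((N : ℂ) * a * S)) = S :=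
    fun S => by field_simp
  rw [key]
  refine sum_congr rfl fun j _ => ?_
  rw [show (j : ℤ) + p * h - (p * h + p * b) = j - p * b by ring]
  split_ifs <;> ring

end Identity

/-! ### The bound of Lemma 3.6 in periodic form -/

section Bound

variable {a H' N : ℕ}

/-- **Tao 2016, Lemma 3.6 (circle method estimate), periodic form with explicit constants.**
Let `N = aH'`, `𝒫` a finite set of naturals with coefficients `|c_p| ≤ 1` (`p ∈ 𝒫`),
`σ = ∑_{p∈𝒫} 1/p`, `x₁, x₂ : ℤ → ℂ` `N`-periodic and `1`-bounded, `δ ≥ 0`. Then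
`|∑_{p∈𝒫} (c_p/p) ∑_{j ∈ ℤ/Nℤ} 1_{j ≡ pb (a)} x₁(j) x₂(j + ph)| ≤ N (δ + σ ∑_{ξ ∈ Ξ} |G₁(ξ)|)`,
`G₁ = dft N x₁`, where `Ξ = {ξ : |S(-(b+h)η/a - hξ/N)| ≥ δ for some η}`: the explicit version
of the last two sentences of the printed proof (those `ξ ∉ Ξ_H` contribute via
Cauchy–Schwarz/Plancherel, those `ξ ∈ Ξ_H` via `|G₂| ≤ 1`, `|S_H| ≤ σ`).
[cite: TaoFMP2016, proof of Lemma 3.6] -/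
theorem lemma36_periodic (ha : 0 < a) (hH' : 0 < H') (hN : N = a * H') (b h : ℤ)
    (P : Finset ℕ) (c : ℕ → ℂ) (hc : ∀ p ∈ P, ‖c p‖ ≤ 1)
    (x₁ x₂ : ℤ → ℂ) (hx₁ : ∀ j, ‖x₁ j‖ ≤ 1) (hx₂ : ∀ j, ‖x₂ j‖ ≤ 1)
    (hx₁p : Function.Periodic x₁ N) (hx₂p : Function.Periodic x₂ N) {δ : ℝ} (hδ : 0 ≤ δ) :
    ‖∑ p ∈ P, c p / p *
        ∑ j ∈ range N, (if (a : ℤ) ∣ (j : ℤ) - p * b then x₁ j * x₂ (j + p * h) else 0)‖ ≤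
      N * (δ + (∑ p ∈ P, (1 / p : ℝ)) * ∑ ξ ∈ Xi P c a N b h δ, ‖dft N x₁ ξ‖) := by
  have hNpos : 0 < N := hN ▸ Nat.mul_pos ha hH'
  set σ : ℝ := ∑ p ∈ P, (1 / p : ℝ) with hσ
  have hσ0 : 0 ≤ σ := sum_nonneg fun p _ => by positivity
  set G₁ : ℤ → ℂ := dft N x₁ with hG₁
  set G₂ : ℤ → ℂ := dft N x₂ with hG₂
  have hx₁' : ∀ j ∈ Icc (1 : ℤ) N, ‖x₁ j‖ ≤ 1 := fun j _ => hx₁ j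
  have hx₂' : ∀ j ∈ Icc (1 : ℤ) N, ‖x₂ j‖ ≤ 1 := fun j _ => hx₂ j
  -- Step 1: the identity, summed against `c_p / p`
  have step1 : ∑ p ∈ P, c p / p *
      ∑ j ∈ range N, (if (a : ℤ) ∣ (j : ℤ) - p * b then x₁ j * x₂ (j + p * h) else 0) =
      (N : ℂ) / a * ∑ η ∈ range a, ∑ ξ ∈ range N,
        G₁ ξ * G₂ (-((η : ℤ) * H' + ξ)) * expSumS P c (alpha a N b h ξ η) := by
    simp_rw [inner_identity ha hH' hN b h _ x₁ x₂ hx₁p hx₂p]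
    unfold expSumS
    simp_rw [mul_sum]
    rw [sum_comm]
    refine sum_congr rfl fun η _ => ?_
    rw [sum_comm]
    refine sum_congr rfl fun ξ _ => sum_congr rfl fun p _ => ?_
    ring
  rw [step1]
  -- Step 2: pointwise bound
  have hS : ∀ θ, ‖expSumS P c θ‖ ≤ σ := fun θ => norm_expSumS_le hc θ
  have point : ∀ ξ ∈ range N, ∀ η ∈ range a,
      ‖G₁ ξ * G₂ (-((η : ℤ) * H' + ξ)) * expSumS P c (alpha a N b h ξ η)‖ ≤
        δ * ((‖G₁ ξ‖ ^ 2 + ‖G₂ (-((η : ℤ) * H' + ξ))‖ ^ 2) / 2) +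
        σ * (if (∃ η' ∈ range a, δ ≤ ‖expSumS P c (alpha a N b h ξ η')‖) then ‖G₁ ξ‖
          else 0) := by
    intro ξ _ η hη
    rw [norm_mul, norm_mul]
    have hu := norm_nonneg (G₁ ξ)
    have hv := norm_nonneg (G₂ (-((η : ℤ) * H' + ξ)))
    have hv1 : ‖G₂ (-((η : ℤ) * H' + ξ))‖ ≤ 1 := norm_dft_le hNpos hx₂' _
    have hw := norm_nonneg (expSumS P c (alpha a N b h ξ η))
    split_ifs with hcase
    · have h1 : ‖G₁ ξ‖ * ‖G₂ (-((η : ℤ) * H' + ξ))‖ * ‖expSumS P c (alpha a N b h ξ η)‖ ≤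
          ‖G₁ ξ‖ * 1 * σ := by gcongr; exact hS _
      have h2 : 0 ≤ δ * ((‖G₁ ξ‖ ^ 2 + ‖G₂ (-((η : ℤ) * H' + ξ))‖ ^ 2) / 2) := by positivity
      nlinarith
    · simp only [not_exists, not_and, not_le] at hcase
      have h1 := hcase η hη
      have h3 : ‖G₁ ξ‖ * ‖G₂ (-((η : ℤ) * H' + ξ))‖ * ‖expSumS P c (alpha a N b h ξ η)‖ ≤
          ‖G₁ ξ‖ * ‖G₂ (-((η : ℤ) * H' + ξ))‖ * δ := by gcongr
      have h4 : 2 * ‖G₁ ξ‖ * ‖G₂ (-((η : ℤ) * H' + ξ))‖ ≤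
          ‖G₁ ξ‖ ^ 2 + ‖G₂ (-((η : ℤ) * H' + ξ))‖ ^ 2 := two_mul_le_add_sq _ _
      nlinarith
  -- Step 3: Plancherel (`TaoCircleMethod.lean`)
  have hP1 : ∑ ξ ∈ range N, ‖G₁ ξ‖ ^ 2 ≤ 1 :=
    sum_norm_sq_dft_comp_le_one hNpos hx₁' (fun ξ => (ξ : ℤ)) (crs_id hNpos)
  have hP2 : ∀ η : ℕ, ∑ ξ ∈ range N, ‖G₂ (-((η : ℤ) * H' + ξ))‖ ^ 2 ≤ 1 := by
    intro η
    have := sum_norm_sq_dft_comp_le_one hNpos hx₂' (fun ξ => -(ξ : ℤ) - η * H')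
      (crs_neg_sub hNpos (η * H'))
    refine le_of_eq_of_le (sum_congr rfl fun ξ _ => ?_) this
    rw [hG₂, show -((η : ℤ) * H' + ξ) = -(ξ : ℤ) - η * H' by ring]
  have inner : ∀ η ∈ range a, ∑ ξ ∈ range N,
      ‖G₁ ξ * G₂ (-((η : ℤ) * H' + ξ)) * expSumS P c (alpha a N b h ξ η)‖ ≤
        δ + σ * ∑ ξ ∈ Xi P c a N b h δ, ‖G₁ ξ‖ := by
    intro η hη
    refine (sum_le_sum fun ξ hξ => point ξ hξ η hη).trans ?_
    rw [sum_add_distrib, ← mul_sum, ← mul_sum, ← sum_filter]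
    have hfirst : ∑ ξ ∈ range N, (‖G₁ ξ‖ ^ 2 + ‖G₂ (-((η : ℤ) * H' + ξ))‖ ^ 2) / 2 ≤ 1 := by
      rw [← sum_div, sum_add_distrib]
      linarith [hP1, hP2 η]
    unfold Xi
    have := mul_le_of_le_one_right hδ hfirst
    linarith
  calc ‖(N : ℂ) / a * ∑ η ∈ range a, ∑ ξ ∈ range N,
          G₁ ξ * G₂ (-((η : ℤ) * H' + ξ)) * expSumS P c (alpha a N b h ξ η)‖
      ≤ (N : ℝ) / a * ∑ η ∈ range a, ∑ ξ ∈ range N,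
          ‖G₁ ξ * G₂ (-((η : ℤ) * H' + ξ)) * expSumS P c (alpha a N b h ξ η)‖ := by
        rw [norm_mul, norm_div, Complex.norm_natCast, Complex.norm_natCast]
        gcongr
        exact (norm_sum_le _ _).trans (sum_le_sum fun η _ => norm_sum_le _ _)
    _ ≤ (N : ℝ) / a * ∑ η ∈ range a, (δ + σ * ∑ ξ ∈ Xi P c a N b h δ, ‖G₁ ξ‖) := by
        gcongr with η hη
        exact inner η hη
    _ = N * (δ + σ * ∑ ξ ∈ Xi P c a N b h δ, ‖G₁ ξ‖) := by
        rw [sum_const, card_range, nsmul_eq_mul]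
        have : (a : ℝ) ≠ 0 := by exact_mod_cast ha.ne'
        field_simp

end Bound

/-! ### The bilinear form with coefficients and the truncation error -/

section Truncation

/-- The left side of Lemma 3.6 with coefficients:
`T = ∑_{p ∈ 𝒫} (c_p/p) ∑_{j : j, j + ph ∈ [1, H], j ≡ pb (a)} x₁(j) x₂(j + ph)`
(this is `Literature.NumberTheory.LFunctions.Tao2016.bilin` with the phases `c_p`). [cite: TaoFMP2016, Lemma 3.6] -/
noncomputable def bilinC (H a : ℕ) (b h : ℤ) (P : Finset ℕ) (c : ℕ → ℂ) (x₁ x₂ : ℤ → ℂ) : ℂ :=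
  ∑ p ∈ P, c p / p * ∑ j ∈ (Icc (1 : ℤ) H).filter
    (fun j => j + p * h ∈ Icc (1 : ℤ) H ∧ (a : ℤ) ∣ j - p * b), x₁ j * x₂ (j + p * h)

/-- `bilin = bilinC` at `c = 1`. [folklore] -/
theorem bilin_eq_bilinC_one (H a : ℕ) (b h : ℤ) (P : Finset ℕ) (x₁ x₂ : ℤ → ℂ) :
    bilin H a b h P x₁ x₂ = bilinC H a b h P 1 x₁ x₂ := by
  unfold bilin bilinC
  refine sum_congr rfl fun p _ => ?_
  rw [Pi.one_apply]

variable {a H' N : ℕ}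

/-- **Truncation error** (Tao 2016, proof of Lemma 3.6: "If we remove the constraint that
`j + ph ∈ [1, H]`, we incur an error of `O(∑_{p ∈ 𝒫_H} (1/p) |ph|)`"): replacing the
constrained sum by the sum over `ℤ/Nℤ` of the periodic extensions `x̃ᵢ = pext N xᵢ` costs at
most `|h| · #𝒫` (via `card_filter_add_not_mem_Icc_le`). [cite: TaoFMP2016, proof of Lemma 3.6] -/
theorem norm_bilinC_sub_periodic_le (ha : 0 < a) (hH' : 0 < H') (hN : N = a * H') (b h : ℤ)
    (P : Finset ℕ) (c : ℕ → ℂ) (hc : ∀ p ∈ P, ‖c p‖ ≤ 1)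
    (x₁ x₂ : ℤ → ℂ) (hx₁ : ∀ j ∈ Icc (1 : ℤ) N, ‖x₁ j‖ ≤ 1)
    (hx₂ : ∀ j ∈ Icc (1 : ℤ) N, ‖x₂ j‖ ≤ 1) :
    ‖bilinC N a b h P c x₁ x₂ -
      ∑ p ∈ P, c p / p *
        ∑ j ∈ range N, (if (a : ℤ) ∣ (j : ℤ) - p * b then
          pext N x₁ j * pext N x₂ (j + p * h) else 0)‖ ≤ |(h : ℝ)| * P.card := by
  have hNpos : 0 < N := hN ▸ Nat.mul_pos ha hH'
  have hdvd : (a : ℤ) ∣ (N : ℤ) := dvd_of_eq_mul hN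
  unfold bilinC
  rw [← sum_sub_distrib]
  simp_rw [← mul_sub]
  -- per-`p` bound
  have per : ∀ p ∈ P,
      ‖∑ j ∈ (Icc (1 : ℤ) N).filter (fun j => j + p * h ∈ Icc (1 : ℤ) N ∧ (a : ℤ) ∣ j - p * b),
          x₁ j * x₂ (j + p * h) -
        ∑ j ∈ range N, (if (a : ℤ) ∣ (j : ℤ) - p * b then
          pext N x₁ j * pext N x₂ (j + p * h) else 0)‖ ≤ p * |(h : ℝ)| := by
    intro p _
    -- move the periodic sum to `[1, N]`
    set F : ℤ → ℂ := fun j => if (a : ℤ) ∣ j - p * b then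
      pext N x₁ j * pext N x₂ (j + p * h) else 0 with hF
    have hFp : Function.Periodic F N := by
      intro j
      simp only [hF]
      rw [show j + (N : ℤ) + p * h = j + p * h + N by ring, pext_periodic hNpos,
        pext_periodic hNpos]
      congr 1
      rw [show j + (N : ℤ) - p * b = (j - p * b) + N by ring]
      simp only [dvd_add_left hdvd]
    have hshift := sum_Icc_int_eq_sum_range_of_periodic hNpos hFp
    simp only [hF] at hshift
    rw [← hshift, sum_filter, ← sum_sub_distrib]
    -- pointwise
    set bad : ℤ → Prop := fun j => j + p * h ∉ Icc (1 : ℤ) N with hbad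
    have point : ∀ j ∈ Icc (1 : ℤ) N,
        ‖(if j + p * h ∈ Icc (1 : ℤ) N ∧ (a : ℤ) ∣ j - p * b then x₁ j * x₂ (j + p * h) else 0) -
          (if (a : ℤ) ∣ j - p * b then pext N x₁ j * pext N x₂ (j + p * h) else 0)‖ ≤
          if bad j then 1 else 0 := by
      intro j hj
      by_cases hgood : j + p * h ∈ Icc (1 : ℤ) N
      · have : ¬bad j := fun hb => hb hgood
        rw [if_neg this, pext_eq_self hNpos x₁ hj, pext_eq_self hNpos x₂ hgood]
        by_cases hd : (a : ℤ) ∣ j - p * b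
        · rw [if_pos ⟨hgood, hd⟩, if_pos hd, sub_self, norm_zero]
        · rw [if_neg (fun h' => hd h'.2), if_neg hd, sub_self, norm_zero]
      · have : bad j := hgood
        rw [if_pos this, if_neg (fun h' => hgood h'.1), zero_sub, norm_neg]
        split_ifs
        · rw [norm_mul]
          have h1 := norm_pext_le hNpos hx₁ j
          have h2 := norm_pext_le hNpos hx₂ (j + p * h)
          have := norm_nonneg (pext N x₁ j)
          nlinarith
        · simp
    refine (norm_sum_le _ _).trans ((sum_le_sum point).trans ?_)
    rw [sum_boole]
    have h1 := card_filter_add_not_mem_Icc_le N ((p : ℤ) * h)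
    have h2 : ((((Icc (1 : ℤ) N).filter bad).card : ℤ) : ℝ) ≤ ((|(p : ℤ) * h| : ℤ) : ℝ) := by
      exact_mod_cast h1
    push_cast at h2
    rw [abs_mul, Nat.abs_cast] at h2
    exact h2
  refine (norm_sum_le _ _).trans ?_
  have hfin : ∀ p ∈ P, ‖c p / p *
      (∑ j ∈ (Icc (1 : ℤ) N).filter (fun j => j + p * h ∈ Icc (1 : ℤ) N ∧ (a : ℤ) ∣ j - p * b),
          x₁ j * x₂ (j + p * h) -
        ∑ j ∈ range N, (if (a : ℤ) ∣ (j : ℤ) - p * b then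
          pext N x₁ j * pext N x₂ (j + p * h) else 0))‖ ≤ |(h : ℝ)| := by
    intro p hp
    rw [norm_mul, norm_div, Complex.norm_natCast]
    rcases Nat.eq_zero_or_pos p with rfl | hp0
    · simp
    calc _ ≤ 1 / (p : ℝ) * (p * |(h : ℝ)|) := by
          gcongr
          · exact hc p hp
          · exact per p hp
      _ = |(h : ℝ)| := by field_simp
  calc _ ≤ ∑ p ∈ P, |(h : ℝ)| := sum_le_sum hfin
    _ = |(h : ℝ)| * P.card := by rw [sum_const, nsmul_eq_mul, mul_comm]

end Truncation

/-! ### The primes `𝒫_H` and Chebyshev's bound -/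

section Primes

/-- `𝒫_H`: "the set of primes between `ε²H/2` and `ε²H`" (Tao 2016, Proposition 2.6).
[cite: TaoFMP2016, Proposition 2.6] -/
noncomputable def primesP (ε : ℝ) (H : ℕ) : Finset ℕ :=
  (Nat.primesLE ⌊ε ^ 2 * H⌋₊).filter fun p => ε ^ 2 * H / 2 ≤ (p : ℝ)

/-- Membership in `𝒫_H`. [folklore] -/
theorem mem_primesP {ε : ℝ} {H p : ℕ} :
    p ∈ primesP ε H ↔ p.Prime ∧ ε ^ 2 * H / 2 ≤ (p : ℝ) ∧ (p : ℝ) ≤ ε ^ 2 * H := by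
  unfold primesP
  rw [mem_filter, Nat.mem_primesLE]
  have h0 : 0 ≤ ε ^ 2 * H := by positivity
  rw [Nat.le_floor_iff h0]
  tauto

/-- Elements of `𝒫_H` are prime. [folklore] -/
theorem prime_of_mem_primesP {ε : ℝ} {H p : ℕ} (hp : p ∈ primesP ε H) : p.Prime :=
  (mem_primesP.1 hp).1

/-- Chebyshev: `#𝒫_H · log(ε²H/2) ≤ θ(ε²H) ≤ (log 4) ε²H`. [folklore] -/
theorem card_primesP_mul_log_le {ε : ℝ} {H : ℕ} (hy : 1 ≤ ε ^ 2 * H / 2) :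
    ((primesP ε H).card : ℝ) * Real.log (ε ^ 2 * H / 2) ≤ Real.log 4 * (ε ^ 2 * H) := by
  have h0 : 0 ≤ ε ^ 2 * H := by positivity
  calc ((primesP ε H).card : ℝ) * Real.log (ε ^ 2 * H / 2)
      = ∑ p ∈ primesP ε H, Real.log (ε ^ 2 * H / 2) := by rw [sum_const, nsmul_eq_mul]
    _ ≤ ∑ p ∈ primesP ε H, Real.log p := by
        refine sum_le_sum fun p hp => Real.log_le_log (by linarith) (mem_primesP.1 hp).2.1
    _ ≤ ∑ p ∈ Nat.primesLE ⌊ε ^ 2 * H⌋₊, Real.log p := by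
        refine sum_le_sum_of_subset_of_nonneg (filter_subset _ _) fun p hp _ => ?_
        exact Real.log_nonneg (by exact_mod_cast (Nat.prime_of_mem_primesLE hp).one_lt.le)
    _ = Chebyshev.theta (ε ^ 2 * H) := (Chebyshev.theta_eq_sum_primesLE _).symm
    _ ≤ Real.log 4 * (ε ^ 2 * H) := Chebyshev.theta_le_log4_mul_x h0

/-- `∑_{p ∈ 𝒫_H} 1/p ≤ 2 #𝒫_H / (ε² H)`. [folklore] -/
theorem sum_inv_primesP_le {ε : ℝ} {H : ℕ} (hy : 0 < ε ^ 2 * H) :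
    ∑ p ∈ primesP ε H, (1 : ℝ) / p ≤ (primesP ε H).card * (2 / (ε ^ 2 * H)) := by
  calc ∑ p ∈ primesP ε H, (1 : ℝ) / p ≤ ∑ p ∈ primesP ε H, 2 / (ε ^ 2 * H) := by
        refine sum_le_sum fun p hp => ?_
        have h1 := (mem_primesP.1 hp).2.1
        rw [div_le_div_iff₀ (by linarith) hy]
        linarith
    _ = (primesP ε H).card * (2 / (ε ^ 2 * H)) := by rw [sum_const, nsmul_eq_mul]

/-- Under `ε⁴ H ≥ 4` (so that `ε²H/2 ≥ √H`): `#𝒫_H ≤ 3 ε² H / log H` and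
`∑_{p∈𝒫_H} 1/p ≤ 6 / log H` ("from the prime number theorem", Tao 2016, proof of Lemma 3.6;
Chebyshev's bound suffices). [folklore] -/
theorem card_primesP_le {ε : ℝ} {H : ℕ} (hε : 0 < ε) (hε1 : ε ≤ 1) (hH : 4 ≤ ε ^ 4 * H) :
    ((primesP ε H).card : ℝ) ≤ 3 * (ε ^ 2 * H) / Real.log H ∧
      ∑ p ∈ primesP ε H, (1 : ℝ) / p ≤ 6 / Real.log H := by
  have hε2 : 0 < ε ^ 2 := by positivity
  have hε4 : ε ^ 4 ≤ 1 := pow_le_one₀ hε.le hε1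
  have hH1 : (4 : ℝ) ≤ H := by nlinarith [hH, (Nat.cast_nonneg H : (0 : ℝ) ≤ H)]
  have hy : 1 ≤ ε ^ 2 * H / 2 := by nlinarith
  -- `log H ≤ 2 log (ε² H / 2)` since `H ≤ (ε² H / 2)²`
  have hsq : (H : ℝ) ≤ (ε ^ 2 * H / 2) ^ 2 := by nlinarith
  have hlogH : 0 < Real.log H := Real.log_pos (by linarith)
  have hlog : Real.log H ≤ 2 * Real.log (ε ^ 2 * H / 2) := by
    rw [← Real.log_rpow (by linarith), Real.rpow_two]  -- hmm
    exact Real.log_le_log (by positivity) hsq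
  have hlog4 : Real.log 4 < 1.3863 := by
    have := Real.log_two_lt_d9
    rw [show (4 : ℝ) = 2 ^ 2 by norm_num, Real.log_pow]; push_cast; linarith
  have hcard := card_primesP_mul_log_le hy
  have hlogy : 0 < Real.log (ε ^ 2 * H / 2) := by linarith
  have hc1 : ((primesP ε H).card : ℝ) ≤ 3 * (ε ^ 2 * H) / Real.log H := by
    rw [le_div_iff₀ hlogH]
    calc ((primesP ε H).card : ℝ) * Real.log H
        ≤ (primesP ε H).card * (2 * Real.log (ε ^ 2 * H / 2)) := by gcongr
      _ = 2 * (((primesP ε H).card : ℝ) * Real.log (ε ^ 2 * H / 2)) := by ring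
      _ ≤ 2 * (Real.log 4 * (ε ^ 2 * H)) := by gcongr
      _ ≤ 3 * (ε ^ 2 * H) := by nlinarith [mul_pos hε2 (by linarith : (0 : ℝ) < H)]
  refine ⟨hc1, ?_⟩
  calc ∑ p ∈ primesP ε H, (1 : ℝ) / p ≤ (primesP ε H).card * (2 / (ε ^ 2 * H)) :=
        sum_inv_primesP_le (by positivity)
    _ ≤ 3 * (ε ^ 2 * H) / Real.log H * (2 / (ε ^ 2 * H)) := by gcongr
    _ = 6 / Real.log H := by field_simp; ring

end Primes

/-! ### Lemma 3.6 as printed -/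

section Paper

/-- **Tao 2016, Lemma 3.6 (circle method estimate), as printed, with explicit constants.**
Let `a ≥ 1`, `a ∣ H`, `b, h ∈ ℤ`, `0 < ε ≤ 1` with `ε⁴ H ≥ 4`; let `𝒫_H` be the primes in
`[ε²H/2, ε²H]`, `c_p` (`p ∈ 𝒫_H`) complex numbers bounded by `1` (in the paper
`c_p = ḡ₁(p) ḡ₂(p) ∈ S¹`), `S_H(θ) = ∑_{p ∈ 𝒫_H} (c_p/p) e(θp)` and `Ξ_H ⊆ ℤ/Hℤ` the set of `ξ`
with `|S_H(-(b+h)η/a - hξ/H)| ≥ ε²/log H` for some `η ∈ ℤ/aℤ`. Then for complex numbers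
`x_{1,j}, x_{2,j}` (`1 ≤ j ≤ H`) bounded in magnitude by one,
`|∑_{p ∈ 𝒫_H} (c_p/p) ∑_{1 ≤ j ≤ H, 1 ≤ j + ph ≤ H, j ≡ pb (a)} x_{1,j} x_{2,j+ph}|
  ≤ C_h (H / log H) (ε² + ∑_{ξ ∈ Ξ_H} |G₁(ξ)|)`, `G₁(ξ) = (1/H) ∑_{j=1}^{H} x_{1,j} e(-jξ/H)`
(`= dft H x₁ ξ`), with `C_h = 6 + 3|h|` (the paper: `≪_{a,h}`; our constant is uniform in `a`).
[cite: TaoFMP2016, Lemma 3.6] -/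
theorem lemma36 {a H : ℕ} (ha : 0 < a) (haH : a ∣ H) (b h : ℤ) {ε : ℝ} (hε : 0 < ε)
    (hε1 : ε ≤ 1) (hH : 4 ≤ ε ^ 4 * H) (c : ℕ → ℂ) (hc : ∀ p ∈ primesP ε H, ‖c p‖ ≤ 1)
    (x₁ x₂ : ℤ → ℂ) (hx₁ : ∀ j ∈ Icc (1 : ℤ) H, ‖x₁ j‖ ≤ 1)
    (hx₂ : ∀ j ∈ Icc (1 : ℤ) H, ‖x₂ j‖ ≤ 1) :
    ‖bilinC H a b h (primesP ε H) c x₁ x₂‖ ≤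
      (6 + 3 * |(h : ℝ)|) * (H / Real.log H) *
        (ε ^ 2 + ∑ ξ ∈ Xi (primesP ε H) c a H b h (ε ^ 2 / Real.log H), ‖dft H x₁ ξ‖) := by
  obtain ⟨H', hN⟩ := haH
  have hε4 : ε ^ 4 ≤ 1 := pow_le_one₀ hε.le hε1
  have hH4 : (4 : ℝ) ≤ H := by nlinarith [hH, (Nat.cast_nonneg H : (0 : ℝ) ≤ H)]
  have hHpos : 0 < H := by exact_mod_cast (by linarith : (0 : ℝ) < H)
  have hH' : 0 < H' := Nat.pos_of_ne_zero fun h0 => by simp [h0] at hN; omega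
  have hlogH : 0 < Real.log H := Real.log_pos (by linarith)
  obtain ⟨hcard, hσ⟩ := card_primesP_le hε hε1 hH
  set P := primesP ε H with hP
  set δ : ℝ := ε ^ 2 / Real.log H with hδ
  have hδ0 : 0 ≤ δ := by positivity
  set X₁ := pext H x₁ with hX₁
  set X₂ := pext H x₂ with hX₂
  -- the periodic main term
  have hmain := lemma36_periodic ha hH' hN b h P c hc X₁ X₂
    (norm_pext_le hHpos hx₁) (norm_pext_le hHpos hx₂) (pext_periodic hHpos x₁)
    (pext_periodic hHpos x₂) hδ0
  -- the truncation error
  have htrunc := norm_bilinC_sub_periodic_le ha hH' hN b h P c hc x₁ x₂ hx₁ hx₂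
  -- `dft` of the periodic extension is `dft` of the sequence
  have hdft : ∀ ξ : ℤ, dft H X₁ ξ = dft H x₁ ξ := by
    intro ξ
    rw [hX₁]
    unfold dft
    congr 1
    exact sum_congr rfl fun j hj => by rw [pext_eq_self hHpos x₁ hj]
  simp_rw [hdft] at hmain
  set Sx : ℝ := ∑ ξ ∈ Xi P c a H b h δ, ‖dft H x₁ ξ‖ with hSx
  have hSx0 : 0 ≤ Sx := sum_nonneg fun ξ _ => norm_nonneg _
  set σ : ℝ := ∑ p ∈ P, (1 / p : ℝ) with hσdef
  have hσ0 : 0 ≤ σ := sum_nonneg fun p _ => by positivity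
  -- combine
  have htot : ‖bilinC H a b h P c x₁ x₂‖ ≤ |(h : ℝ)| * P.card + H * (δ + σ * Sx) :=
    (norm_le_norm_sub_add _ _).trans (add_le_add htrunc hmain)
  refine htot.trans ?_
  have habs : 0 ≤ |(h : ℝ)| := abs_nonneg _
  have hHL : 0 ≤ (H : ℝ) / Real.log H := by positivity
  calc |(h : ℝ)| * P.card + H * (δ + σ * Sx)
      ≤ |(h : ℝ)| * (3 * (ε ^ 2 * H) / Real.log H) + H * (δ + 6 / Real.log H * Sx) := by
        gcongr
    _ = (H / Real.log H) * (3 * |(h : ℝ)| * ε ^ 2 + ε ^ 2 + 6 * Sx) := by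
        rw [hδ]; field_simp; ring
    _ ≤ (H / Real.log H) * ((6 + 3 * |(h : ℝ)|) * (ε ^ 2 + Sx)) := by
        gcongr
        nlinarith [sq_nonneg ε, mul_nonneg habs hSx0]
    _ = (6 + 3 * |(h : ℝ)|) * (H / Real.log H) * (ε ^ 2 + Sx) := by ring

end Paper

/-! ### Few large frequencies (towards Lemma 3.7) for general coefficients -/

section LargeFreq

/-- `|S(α)|²` as a double sum: `|S(α)|² = ∑_{p,p'} c_p c̄_{p'} e((p - p')α) / (p p')`. [folklore] -/
theorem normSq_expSumS (P : Finset ℕ) (c : ℕ → ℂ) (α : ℝ) :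
    (((‖expSumS P c α‖ ^ 2 : ℝ)) : ℂ) =
      ∑ q ∈ P ×ˢ P, c q.1 * conj (c q.2) / ((q.1 : ℂ) * q.2) *
        e (α * ((((q.1 : ℤ) - q.2 : ℤ)) : ℝ)) := by
  rw [← Complex.normSq_eq_norm_sq, ← Complex.mul_conj]
  unfold expSumS
  rw [map_sum, sum_mul_sum, ← sum_product']
  refine sum_congr rfl fun q _ => ?_
  rw [map_mul, map_div₀, map_natCast, ← e_neg, mul_mul_mul_comm, ← e_add, div_mul_div_comm]
  congr 1
  push_cast
  ring_nf

/-- `|S(α)|⁴` as a sum over pairs of pairs `q = ((p₁, p₃), (p₂, p₄))`: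
`|S(α)|⁴ = ∑_q W(q) e((p₁ - p₃ + p₂ - p₄)α)`, `W(q) = c₁c̄₃c₂c̄₄/(p₁p₃p₂p₄)`. [folklore] -/
theorem norm_expSumS_pow_four (P : Finset ℕ) (c : ℕ → ℂ) (α : ℝ) :
    (((‖expSumS P c α‖ ^ 4 : ℝ)) : ℂ) =
      ∑ q ∈ (P ×ˢ P) ×ˢ (P ×ˢ P),
        (c q.1.1 * conj (c q.1.2) / ((q.1.1 : ℂ) * q.1.2)) *
          (c q.2.1 * conj (c q.2.2) / ((q.2.1 : ℂ) * q.2.2)) *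
          e (α * ((((q.1.1 : ℤ) - q.1.2 + q.2.1 - q.2.2 : ℤ)) : ℝ)) := by
  rw [show (‖expSumS P c α‖ ^ 4 : ℝ) = ‖expSumS P c α‖ ^ 2 * ‖expSumS P c α‖ ^ 2 by ring]
  push_cast
  rw [show ((‖expSumS P c α‖ : ℂ)) ^ 2 = (((‖expSumS P c α‖ ^ 2 : ℝ)) : ℂ) by push_cast; ring,
    normSq_expSumS, sum_mul_sum, ← sum_product']
  refine sum_congr rfl fun q _ => ?_
  rw [mul_mul_mul_comm, ← e_add]
  congr 1
  push_cast
  ring_nf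

variable {a H' N : ℕ}

/-- **Few large frequencies via the fourth moment**, general coefficients (first half of the
proof of Tao 2016, Lemma 3.7, with the restriction estimate replaced by a count of additive
quadruples as in the footnote there): if `N = aH'`, `𝒫 ⊆ [p_min, p_max]` with
`2|h| p_max < N`, `|c_p| ≤ 1`, `h ≠ 0` and `δ > 0`, then
`#Ξ ≤ a N δ⁻⁴ p_min⁻⁴ · #{(p₁,p₂,p₃,p₄) ∈ 𝒫⁴ : p₁ + p₂ = p₃ + p₄}`
(`Literature.NumberTheory.LFunctions.Tao2016.addQuadruples` of `TaoCircleMethod.lean`).  Proof: `1_{|S| ≥ δ} ≤ |S|⁴/δ⁴`, expand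
`|S|⁴`, sum over `ξ` by orthogonality; only quadruples with `N ∣ h(p₁ - p₃ + p₂ - p₄)`, i.e.
`p₁ + p₂ = p₃ + p₄`, survive, each weighted by at most `p_min⁻⁴`.
[cite: TaoFMP2016, Lemma 3.7 (proof and footnote)] -/
theorem card_Xi_le (ha : 0 < a) (hH' : 0 < H') (hN : N = a * H') (b h : ℤ) (hh : h ≠ 0)
    (P : Finset ℕ) (c : ℕ → ℂ) (hc : ∀ p ∈ P, ‖c p‖ ≤ 1) {pmin pmax : ℕ} (hpmin : 0 < pmin)
    (hP : ∀ p ∈ P, pmin ≤ p ∧ p ≤ pmax) (hsmall : 2 * |h| * pmax < N) {δ : ℝ} (hδ : 0 < δ) :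
    ((Xi P c a N b h δ).card : ℝ) ≤
      a * N * (δ⁻¹) ^ 4 * ((pmin : ℝ)⁻¹) ^ 4 * (addQuadruples P).card := by
  have hNpos : 0 < N := hN ▸ Nat.mul_pos ha hH'
  set S := fun ξ η : ℕ => expSumS P c (alpha a N b h ξ η) with hS
  -- Step 1: Markov
  have step1 : ((Xi P c a N b h δ).card : ℝ) ≤
      (δ⁻¹) ^ 4 * ∑ ξ ∈ range N, ∑ η ∈ range a, ‖S ξ η‖ ^ 4 := by
    have h1 : ((Xi P c a N b h δ).card : ℝ) = ∑ ξ ∈ Xi P c a N b h δ, (1 : ℝ) := by simp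
    rw [h1, mul_sum, ← sum_sdiff (Xi_subset P c a N b h δ)]
    have hnn : 0 ≤ ∑ ξ ∈ range N \ Xi P c a N b h δ,
        (δ⁻¹) ^ 4 * ∑ η ∈ range a, ‖S ξ η‖ ^ 4 :=
      sum_nonneg fun ξ _ => mul_nonneg (by positivity) (sum_nonneg fun η _ => by positivity)
    refine le_add_of_nonneg_of_le hnn (sum_le_sum fun ξ hξ => ?_)
    unfold Xi at hξ
    rw [mem_filter] at hξ
    obtain ⟨_, η, hη, hle⟩ := hξ
    rw [mul_sum]
    calc (1 : ℝ) ≤ (δ⁻¹) ^ 4 * ‖S ξ η‖ ^ 4 := by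
          rw [show (δ⁻¹) ^ 4 * ‖S ξ η‖ ^ 4 = (‖S ξ η‖ / δ) ^ 4 by ring]
          exact one_le_pow₀ ((one_le_div hδ).2 hle)
      _ ≤ ∑ η' ∈ range a, (δ⁻¹) ^ 4 * ‖S ξ η'‖ ^ 4 :=
          single_le_sum (f := fun η' => (δ⁻¹) ^ 4 * ‖S ξ η'‖ ^ 4)
            (fun η' _ => by positivity) hη
  -- Step 2: for each `η`, `∑_{ξ < N} |S|⁴ ≤ N p_min⁻⁴ #quadruples`
  have step2 : ∀ η ∈ range a, ∑ ξ ∈ range N, ‖S ξ η‖ ^ 4 ≤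
      N * ((pmin : ℝ)⁻¹) ^ 4 * (addQuadruples P).card := by
    intro η _
    set M : (ℕ × ℕ) × (ℕ × ℕ) → ℤ := fun q => (q.1.1 : ℤ) - q.1.2 + q.2.1 - q.2.2 with hM
    set W : (ℕ × ℕ) × (ℕ × ℕ) → ℂ := fun q =>
      (c q.1.1 * conj (c q.1.2) / ((q.1.1 : ℂ) * q.1.2)) *
        (c q.2.1 * conj (c q.2.2) / ((q.2.1 : ℂ) * q.2.2)) with hW
    -- expand and separate the `ξ`-dependence
    have e1 : ∀ ξ : ℕ, (((‖S ξ η‖ ^ 4 : ℝ)) : ℂ) = ∑ q ∈ (P ×ˢ P) ×ˢ (P ×ˢ P),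
        W q * (e (-(((b : ℝ) + h) * η * (M q) / a)) *
          e ((((-(h * M q) : ℤ)) : ℝ) * (ξ : ℕ) / N)) := by
      intro ξ
      simp only [hS]
      rw [norm_expSumS_pow_four]
      refine sum_congr rfl fun q _ => ?_
      simp only [hW, hM]
      rw [← e_add]
      congr 1
      unfold alpha
      push_cast
      ring_nf
    have e2 : ∀ q ∈ (P ×ˢ P) ×ˢ (P ×ˢ P),
        ∑ ξ ∈ range N, W q * (e (-(((b : ℝ) + h) * η * (M q) / a)) *
          e ((((-(h * M q) : ℤ)) : ℝ) * (ξ : ℕ) / N)) =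
        W q * (e (-(((b : ℝ) + h) * η * (M q) / a)) *
          (if (N : ℤ) ∣ -(h * M q) then (N : ℂ) else 0)) := by
      intro q _
      rw [← mul_sum, ← mul_sum]
      have := sum_e_mul_div (-(h * M q)) hNpos
      push_cast at this ⊢
      rw [this]
    have hWle : ∀ q ∈ (P ×ˢ P) ×ˢ (P ×ˢ P), ‖W q‖ ≤ ((pmin : ℝ)⁻¹) ^ 4 := by
      intro q hq
      simp only [mem_product] at hq
      obtain ⟨⟨h11, h12⟩, h21, h22⟩ := hq
      simp only [hW]
      rw [norm_mul, norm_div, norm_div, norm_mul, norm_mul, norm_mul, norm_mul,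
        Complex.norm_conj, Complex.norm_conj, Complex.norm_natCast, Complex.norm_natCast,
        Complex.norm_natCast, Complex.norm_natCast]
      have hb1 : (pmin : ℝ) ≤ q.1.1 := by exact_mod_cast (hP _ h11).1
      have hb2 : (pmin : ℝ) ≤ q.1.2 := by exact_mod_cast (hP _ h12).1
      have hb3 : (pmin : ℝ) ≤ q.2.1 := by exact_mod_cast (hP _ h21).1
      have hb4 : (pmin : ℝ) ≤ q.2.2 := by exact_mod_cast (hP _ h22).1
      have hpm : (0 : ℝ) < pmin := by exact_mod_cast hpmin
      have hq1 : (0 : ℝ) < (q.1.1 : ℝ) * q.1.2 := mul_pos (hpm.trans_le hb1) (hpm.trans_le hb2)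
      have hq2 : (0 : ℝ) < (q.2.1 : ℝ) * q.2.2 := mul_pos (hpm.trans_le hb3) (hpm.trans_le hb4)
      have hA : ‖c q.1.1‖ * ‖c q.1.2‖ / ((q.1.1 : ℝ) * q.1.2) ≤ 1 / ((pmin : ℝ) * pmin) := by
        rw [div_le_div_iff₀ hq1 (by positivity)]
        exact mul_le_mul (mul_le_one₀ (hc _ h11) (norm_nonneg _) (hc _ h12))
          (mul_le_mul hb1 hb2 hpm.le (by positivity)) (by positivity) zero_le_one
      have hB : ‖c q.2.1‖ * ‖c q.2.2‖ / ((q.2.1 : ℝ) * q.2.2) ≤ 1 / ((pmin : ℝ) * pmin) := by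
        rw [div_le_div_iff₀ hq2 (by positivity)]
        exact mul_le_mul (mul_le_one₀ (hc _ h21) (norm_nonneg _) (hc _ h22))
          (mul_le_mul hb3 hb4 hpm.le (by positivity)) (by positivity) zero_le_one
      calc ‖c q.1.1‖ * ‖c q.1.2‖ / ((q.1.1 : ℝ) * q.1.2) *
            (‖c q.2.1‖ * ‖c q.2.2‖ / ((q.2.1 : ℝ) * q.2.2))
          ≤ 1 / ((pmin : ℝ) * pmin) * (1 / ((pmin : ℝ) * pmin)) :=
            mul_le_mul hA hB (by positivity) (by positivity)
        _ = ((pmin : ℝ)⁻¹) ^ 4 := by field_simp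
    -- divisibility forces an additive quadruple
    have hdvd : ∀ q ∈ (P ×ˢ P) ×ˢ (P ×ˢ P), (N : ℤ) ∣ -(h * M q) → q ∈ addQuadruples P := by
      intro q hq hdiv
      unfold addQuadruples
      rw [mem_filter]
      refine ⟨hq, ?_⟩
      simp only [mem_product] at hq
      obtain ⟨⟨h11, h12⟩, h21, h22⟩ := hq
      by_contra hm
      have hm0 : M q ≠ 0 := by
        intro h0
        apply hm
        simp only [hM] at h0
        omega
      have hb1 := hP _ h11
      have hb2 := hP _ h12
      have hb3 := hP _ h21
      have hb4 := hP _ h22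
      have hmabs : |M q| < 2 * pmax := by
        rw [hM, abs_lt]
        simp only
        constructor <;> omega
      rw [dvd_neg] at hdiv
      obtain ⟨k, hk⟩ := hdiv
      have hk0 : k ≠ 0 := by
        rintro rfl
        rw [mul_zero, mul_eq_zero] at hk
        exact hk.elim hh hm0
      have h1 : |h * M q| < N := by
        rw [abs_mul]
        calc |h| * |M q| ≤ |h| * (2 * pmax) := by gcongr
          _ = 2 * |h| * pmax := by ring
          _ < N := hsmall
      rw [hk, abs_mul, Nat.abs_cast] at h1
      have : (1 : ℤ) ≤ |k| := Int.one_le_abs hk0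
      have hN1 : (0 : ℤ) < N := by exact_mod_cast hNpos
      nlinarith
    -- assemble
    have key : (((∑ ξ ∈ range N, ‖S ξ η‖ ^ 4 : ℝ)) : ℂ) =
        ∑ q ∈ (P ×ˢ P) ×ˢ (P ×ˢ P), W q * (e (-(((b : ℝ) + h) * η * (M q) / a)) *
          (if (N : ℤ) ∣ -(h * M q) then (N : ℂ) else 0)) := by
      rw [Complex.ofReal_sum, sum_congr rfl fun ξ _ => e1 ξ, sum_comm]
      exact sum_congr rfl e2
    have hreal : ∑ ξ ∈ range N, ‖S ξ η‖ ^ 4 = ‖(((∑ ξ ∈ range N, ‖S ξ η‖ ^ 4 : ℝ)) : ℂ)‖ := by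
      rw [Complex.norm_real, Real.norm_eq_abs, abs_of_nonneg (sum_nonneg fun _ _ => by positivity)]
    rw [hreal, key]
    refine (norm_sum_le _ _).trans ?_
    calc ∑ q ∈ (P ×ˢ P) ×ˢ (P ×ˢ P), ‖W q * (e (-(((b : ℝ) + h) * η * (M q) / a)) *
            (if (N : ℤ) ∣ -(h * M q) then (N : ℂ) else 0))‖
        ≤ ∑ q ∈ (P ×ˢ P) ×ˢ (P ×ˢ P),
            (if q ∈ addQuadruples P then (N : ℝ) * ((pmin : ℝ)⁻¹) ^ 4 else 0) := by
          refine sum_le_sum fun q hq => ?_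
          by_cases hdiv' : (N : ℤ) ∣ -(h * M q)
          · rw [if_pos hdiv', if_pos (hdvd q hq hdiv'), norm_mul (W q), norm_mul (e _), norm_e,
              one_mul, Complex.norm_natCast, mul_comm]
            gcongr
            exact hWle q hq
          · rw [if_neg hdiv', mul_zero, mul_zero, norm_zero]
            split_ifs <;> positivity
      _ = N * ((pmin : ℝ)⁻¹) ^ 4 * (addQuadruples P).card := by
          rw [← sum_filter, Finset.filter_mem_eq_inter,
            (Finset.inter_eq_right.2 (filter_subset _ _) : (P ×ˢ P) ×ˢ (P ×ˢ P) ∩ addQuadruples P = addQuadruples P),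
            sum_const, nsmul_eq_mul]
          ring
  -- combine
  calc ((Xi P c a N b h δ).card : ℝ)
      ≤ (δ⁻¹) ^ 4 * ∑ ξ ∈ range N, ∑ η ∈ range a, ‖S ξ η‖ ^ 4 := step1
    _ = (δ⁻¹) ^ 4 * ∑ η ∈ range a, ∑ ξ ∈ range N, ‖S ξ η‖ ^ 4 := by rw [sum_comm]
    _ ≤ (δ⁻¹) ^ 4 * ∑ η ∈ range a, ((N : ℝ) * ((pmin : ℝ)⁻¹) ^ 4 * (addQuadruples P).card) := by
        gcongr with η hη
        exact step2 η hη
    _ = a * N * (δ⁻¹) ^ 4 * ((pmin : ℝ)⁻¹) ^ 4 * (addQuadruples P).card := by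
        rw [sum_const, card_range, nsmul_eq_mul]; ring

end LargeFreq

end Tao2016
end Literature.NumberTheory.LFunctions
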